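import Literature.MathematicalPhysics.QuantumFieldTheory.Balaban1983to89.Node00.OpsYOfLetters

/-!
# NODE 00 — the U-LETTER TWO-CONFIGURATION READERS `kernelFamilySU` ∕ `kernelFamilyBU` (Theorem 3.4's readings AT PRODUCTS `U′U`:
# letters of the BASE `U`, operator at the PRODUCT)

[B9] = Bałaban, *Propagators for lattice gauge theories in a background field*, CMP 99 (1985) 389–434: Thm 3.1 (3.39)–(3.47) pp.397–398, Thm 3.3 p.399,
Thm 3.4 p.400 («the operators G′(U), (Q′(U)G′²(U)Q′*(U))⁻¹, R(U), G(U) extend to configurations U′U for α₁ ≦ a₁ as analytic functions of A. The extended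
operators satisfy all the inequalities of Theorems 3.1–3.3 correspondingly»), its proof (3.54) p.402 («|(V′₁(A)λ)(x)| ≤ 4dα₁(Lʲη)⁻¹|∇_Uλ| + …»), (3.61), (3.63)–(3.64)
pp.402–403; the norms (3.39)–(3.40) p.397 are «determined by a configuration U» (Hölder quotients with `R(U(Γ_{x,x′}))`).

WHY THIS FILE (RULING on dag-n06-c g11's LOCATED-11, fleet bus l.36489; this seat's INTENT-45).  def-Y's one-configuration readers
`Node00.OpsYOfLetters.kernelFamilyS i B cfg O par` (site sector, G′) and `kernelFamilyB i B cfg O par` (bond sector, G) bind ONE configuration `U := cfg U′`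
for everything: the letter `O U`, the covariant differences `cdS ∕ cdsS ∕ lapS i U` (resp. `cdB ∕ cdsB ∕ lapB`), and the transporters `par U` of the Hölder
quotients `hqS` ∕ `holderQB`.  Read at a PRODUCT `W = U′U` of print's complex class (3.37) (as `B9.Thm34Printed` does over the record's carrier `bg9Y`, whose
configurations do not remember `U`), the Hölder members (3.43) ∕ (3.45) transport with the COMPLEX `W` along long contours and are unbounded on the class
(n06-c's witness: a constant-level member, `A′₀ = (α₁∕4)χ·iH∕(Lη)`, a pair at physical distance ½; ratio `e^{α₁L^{k−1}∕4}(Lη)^β∕C → ∞`) — whereas print's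
Theorem 3.4 bounds `G′(U′U)` in the norms OF `U`.  THE READING OF RECORD FOR PRODUCTS (R13-U1) therefore separates the two rôles: this file's
★ `kernelFamilySU i B cfgU cfgW O par` ∕ ★ `kernelFamilyBU i B cfgU cfgW O par` are `kernelFamilyS` ∕ `kernelFamilyB` VERBATIM with every letter of the
background (`cdS, cdsS, lapS, par`, resp. `cdB, cdsB, lapB, par`) at `U := cfgU U′` and the operator at `W := cfgW U′` (`O W`), in ALL six members
(e (3.42), h1 (3.43), e4 (3.44), h2 (3.45), l2 (3.46), glob (3.47)).  Over a carrier remembering the pair — n06-c's coded carrier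
`B9SectBCodedCarrier.CCfg` ∕ `codingYx` with `cfgU := baseY` (`prod U a ↦ U`) and `cfgW := decY` (`prod U a ↦ (decA a)·U`) — `B9.Thm34Printed` over these
families IS print's statement; at base configurations (`cfgU = cfgW`) they ARE the record's readings (`kernelFamilySU_self`, `kernelFamilyBU_self`, rfl),
so `operatorLayerYOfLetters` (the reading at `G`-valued configurations) is untouched.  The Hölder member `h1` is, by `rfl`, n06-c's reader-agnostic
`h1ReadT i T par U …` at `T := O (cfgW U′)`, `par := par (cfgU U′)`, `U := cfgU U′` (`kernelFamilySU_h1_inl′`).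

WHAT IS IN THE FILE (`def`s + `rfl` ∕ case-split faces; 0 sorry).  §1 ★ `kernelFamilySU`, its member faces `_e_inl ∕ _h1_inl ∕ _h1_inl′ ∕ _e4_inl ∕ _h2_inl ∕ _l2_inl
∕ _glob_inl`, the `.inr` zeros, ★ `kernelFamilySU_self`; §1.1 the POINTWISE agreement `kernelFamilySU_{e,h1,e4,h2,l2,glob}_congr`: at a configuration with
`cfgU U′ = cfgW U′` (every BASE configuration of a coding) each member IS `kernelFamilyS … cfgW`'s — R13-U1 changes nothing at bases; §2 ★ `kernelFamilyBU`, faces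
`_e_inr ∕ _h1_inr ∕ _e4_inr ∕ _h2_inr ∕ _l2_inr ∕ _glob_inr`, the `.inl` zeros, ★ `kernelFamilyBU_self`, §2.1 `kernelFamilyBU_{…}_congr`; §3 at a member of record: `kernelFamilySU_id_id_eq_Gp` ∕ `kernelFamilyBU_id_id_eq_GA` (over `bg9Y` with both decodings the identity the
readers ARE `operatorLayerYOfLetters`'s `Gp` ∕ `GA`).

HONEST SCOPE.  READINGS (how print's U-letter norms of Theorem 3.4 are instantiated at products) — definitions and `rfl` bookkeeping over def-Y's
`OpsYOfLetters`; no carrier is constructed here (the pair-remembering carrier is n06-c's `B9SectBCodedCarrier`, consumed through the parameters `cfgU ∕ cfgW`);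
nothing of [B9] Thms 3.1–3.4 is asserted or proved; no operator is constructed; COUNT-NEUTRAL; N06 NOT discharged; one finite 𝕋⁴ programme at fixed ε —
nothing continuum, nothing about the mass gap.  Cell `pub-ymgap` (HUMAN RULING D-0062), Track A node N06 [B9] row 13, seat `pub-ymgap-node00-def-Y` (g22), 2026-08-28.

RELATED IN THE TREE, NOT DUPLICATED: `Node00.OpsYOfLetters` (`kernelFamilyS`, `kernelFamilyB`, `eLatS`, `hLatS`, `hqS`, `holderQB`, … USED BY NAME; byte-stable),
`B9SectBGpReadingsY.kernelFamilySC` (n06-c: the (3.42) entries already split `(baseY, decY)` via `eLatSC`, the other members inherited from `kernelFamilyS ∘ decY` —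
its successor edition is to be built over `kernelFamilySU`), `B9SectBCodedCarrier` (the carrier; not imported here).
-/

namespace Literature.MathematicalPhysics.QuantumFieldTheory.Balaban1983to89.Node00.OpsYULetters

open B6Ineq2142KLevelV1 (β)
open B6KLevelCensusIndexV1 (KIdx)
open B6Prop22KLevelCensusEta (epow)
open B9PinMembersKLevelV1 (MemberY geo9Y bg9Y)

noncomputable section

variable {d ℓ : ℕ} {hd : 1 ≤ d + 1} {hL : Odd (ℓ + 1) ∧ 1 < ℓ + 1} {b₀ b₁ : ℝ} {Mstar : ℕ}
variable {𝔸 : Type} [NormedRing 𝔸] [NormedAlgebra ℂ 𝔸] [CompleteSpace 𝔸]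

section Reading

variable (i : KIdx d ℓ hd hL b₀ b₁)

/-! ## §1 The site sector (G′): `kernelFamilySU` -/

open Classical in
/-- ★ **THE U-LETTER TWO-CONFIGURATION READING OF A SITE-SECTOR LETTER** (Theorem 3.4's reading at a product `W = U′U`): `kernelFamilyS` verbatim with the
letters of the background — covariant differences `cdS ∕ cdsS`, Laplacian `lapS`, transporters `par` — at the BASE `U := cfgU U′` and the operator at `W := cfgW U′`.
[cite: Balaban1985BackgroundPropagators, Thm 3.4 p.400, (3.54) p.402 («|∇_Uλ|»), (3.39)–(3.47) pp.397–398] -/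
def kernelFamilySU (B : B9.Backgrounds) (cfgU cfgW : B.Cfg → CfgY 𝔸 i) (O : SiteOpY 𝔸 i) (par : SiteParY 𝔸 i) :
    B9.KernelFamily (B9GeoNormsKLevelV1.geo9K i) B where
  e := fun n U' lam b => let U := cfgU U'; let W := cfgW U'; match lam with
    | .inl f => etaS i ^ (epow n) * ⨆ E : BallY 𝔸, eLatS i (fun _ => O W) U (liftY f (E : 𝔸)) (β i.hN i.D i.hk b) n
    | .inr _ => 0
  h1 := fun U' lam α ζ => let U := cfgU U'; let W := cfgW U'; match lam, ζ with
    | .inl f, .inl z => ⨆ E : BallY 𝔸, hLatS i (fun _ => O W) par U (liftY f (E : 𝔸)) α z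
    | _, _ => 0
  e4 := fun U' lam b => let U := cfgU U'; let W := cfgW U'; match lam with
    | .inl f => ⨆ E : BallY 𝔸, ⨆ μ : Fin (d + 1),
        supBlkS' i (β i.hN i.D i.hk b) (fun ν => cdS i U μ (O W (cdsS i U ν (liftY f (E : 𝔸)))))
    | .inr _ => 0
  h2 := fun U' lam α ζ => let U := cfgU U'; let W := cfgW U'; match lam, ζ with
    | .inl f, .inl z => ⨆ E : BallY 𝔸, ⨆ μ : Fin (d + 1), ⨆ ν : Fin (d + 1),
        hqS i (par U) α (fun w => ((z w : ℝ) : ℂ) • cdS i U μ (O W (cdsS i U ν (liftY f (E : 𝔸)))) w)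
    | _, _ => 0
  l2 := fun n U' lam h => let U := cfgU U'; let W := cfgW U'; match lam, h with
    | .inl f, .inl hh => etaS i ^ ((![2, 1, 1, 0, 0, 0] : Fin 6 → ℕ) n) * ⨆ E : BallY 𝔸,
        ((![l2OfY hh (O W (liftY f (E : 𝔸))),
            ⨆ μ : Fin (d + 1), l2OfY hh (cdS i U μ (O W (liftY f (E : 𝔸)))),
            ⨆ μ : Fin (d + 1), l2OfY hh (O W (cdsS i U μ (liftY f (E : 𝔸)))),
            ⨆ μ : Fin (d + 1), ⨆ ν : Fin (d + 1), l2OfY hh (cdS i U μ (O W (cdsS i U ν (liftY f (E : 𝔸))))),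
            ⨆ μ : Fin (d + 1), ⨆ ν : Fin (d + 1), l2OfY hh (cdS i U μ (cdS i U ν (O W (liftY f (E : 𝔸))))),
            ⨆ μ : Fin (d + 1), ⨆ ν : Fin (d + 1), l2OfY hh (O W (cdsS i U μ (cdsS i U ν (liftY f (E : 𝔸)))))] : Fin 6 → ℝ) n)
    | _, _ => 0
  glob := fun n U' lam γ => let U := cfgU U'; let W := cfgW U'; match lam with
    | .inl f => ⨆ E : BallY 𝔸,
        ((![wNormSY i (2 + γ) (fun z => ((etaS i ^ 2 : ℝ) : ℂ) • O W (liftY f (E : 𝔸)) z),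
            ⨆ μ : Fin (d + 1), wNormSY i (1 + γ) (fun z => ((etaS i : ℝ) : ℂ) • cdS i U μ (O W (liftY f (E : 𝔸))) z),
            ⨆ μ : Fin (d + 1), wNormSY i (1 + γ) (fun z => ((etaS i : ℝ) : ℂ) • O W (cdsS i U μ (liftY f (E : 𝔸))) z),
            wNormSY i γ (lapS i U (O W (liftY f (E : 𝔸))))] : Fin 4 → ℝ) n)
    | .inr _ => 0

/-- at equal decodings the U-letter reading IS def-Y's one-configuration reading `kernelFamilyS` (the record at `G`-valued configurations is untouched).
[cite: Balaban1985BackgroundPropagators, Thm 3.1 (3.42)–(3.47) pp.397–398, bookkeeping] -/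
theorem kernelFamilySU_self (B : B9.Backgrounds) (cfg : B.Cfg → CfgY 𝔸 i) (O : SiteOpY 𝔸 i) (par : SiteParY 𝔸 i) :
    kernelFamilySU i B cfg cfg O par = kernelFamilyS i B cfg O par := rfl

variable (B : B9.Backgrounds) (cfgU cfgW : B.Cfg → CfgY 𝔸 i)

/-- (3.42) ON `.inl f`: `η^{epow n}·sup_E eLatS (G′(W)) U (f ⊗ E)` — entries `‖G′(W)Λ‖, ‖∇_{U,μ}G′(W)Λ‖, ‖G′(W)∇*_{U,μ}Λ‖, ‖Δ_U G′(W)Λ‖` on the block.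
[cite: Balaban1985BackgroundPropagators, (3.42) p.397, Thm 3.4 p.400, bookkeeping] -/
theorem kernelFamilySU_e_inl (O : SiteOpY 𝔸 i) (par : SiteParY 𝔸 i) (n : Fin 4) (U' : B.Cfg) (f : SiteY i → ℝ) (b : IBondY i) :
    (kernelFamilySU i B cfgU cfgW O par).e n U' (.inl f) b =
      etaS i ^ (epow n) * ⨆ E : BallY 𝔸, eLatS i (fun _ => O (cfgW U')) (cfgU U') (liftY f (E : 𝔸)) (β i.hN i.D i.hk b) n := rfl

/-- (3.42) OFF (bond-sector argument): `0`. [cite: Balaban1985BackgroundPropagators, (3.42) p.397, bookkeeping] -/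
theorem kernelFamilySU_e_inr (O : SiteOpY 𝔸 i) (par : SiteParY 𝔸 i) (n : Fin 4) (U' : B.Cfg) (J : FBondY i → ℝ) (b : IBondY i) :
    (kernelFamilySU i B cfgU cfgW O par).e n U' (.inr J) b = 0 := rfl

/-- ★ (3.43) ON (`.inl f`, `.inl ζ`): `sup_E hLatS (G′(W)) par U (f ⊗ E) α ζ` — the Hölder quotient `hqS (par U)` of `ζη·∇_{U,μ}(G′(W)Λ)` ∕ `ζη·G′(W)∇*_{U,μ}Λ`:
transporters and differences OF THE BASE `U`. [cite: Balaban1985BackgroundPropagators, (3.43) p.398, (3.40) p.397 («R(U(Γ_{x,x′}))»), Thm 3.4 p.400] -/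
theorem kernelFamilySU_h1_inl (O : SiteOpY 𝔸 i) (par : SiteParY 𝔸 i) (U' : B.Cfg) (f : SiteY i → ℝ) (α : ℝ) (z : SiteY i → ℝ) :
    (kernelFamilySU i B cfgU cfgW O par).h1 U' (.inl f) α (.inl z) =
      ⨆ E : BallY 𝔸, hLatS i (fun _ => O (cfgW U')) par (cfgU U') (liftY f (E : 𝔸)) α z := rfl

/-- ★ (3.43) ON, with the transporter FROZEN at the base (the shape of n06-c's reader-agnostic `h1ReadT i T par U`: `T := G′(W)`, `par := par U`).
[cite: Balaban1985BackgroundPropagators, (3.43) p.398, (3.40) p.397, bookkeeping] -/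
theorem kernelFamilySU_h1_inl' (O : SiteOpY 𝔸 i) (par : SiteParY 𝔸 i) (U' : B.Cfg) (f : SiteY i → ℝ) (α : ℝ) (z : SiteY i → ℝ) :
    (kernelFamilySU i B cfgU cfgW O par).h1 U' (.inl f) α (.inl z) =
      ⨆ E : BallY 𝔸, hLatS i (fun _ => O (cfgW U')) (fun _ => par (cfgU U')) (cfgU U') (liftY f (E : 𝔸)) α z := rfl

/-- (3.43) OFF: `0` (site-sector input with a bond-sector cut-off, or a bond-sector input). [cite: Balaban1985BackgroundPropagators, (3.43) p.398, bookkeeping] -/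
theorem kernelFamilySU_h1_inr (O : SiteOpY 𝔸 i) (par : SiteParY 𝔸 i) (U' : B.Cfg) (J : FBondY i → ℝ) (α : ℝ) (ζ : (SiteY i → ℝ) ⊕ (FBondY i → ℝ)) :
    (kernelFamilySU i B cfgU cfgW O par).h1 U' (.inr J) α ζ = 0 := rfl

/-- (3.44) ON `.inl f`: `sup_E sup_{μ} sup_{z ∈ Δ, ν} ‖∇_{U,μ} G′(W) ∇*_{U,ν} Λ‖`. [cite: Balaban1985BackgroundPropagators, (3.44) p.398, Thm 3.4 p.400, bookkeeping] -/
theorem kernelFamilySU_e4_inl (O : SiteOpY 𝔸 i) (par : SiteParY 𝔸 i) (U' : B.Cfg) (f : SiteY i → ℝ) (b : IBondY i) :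
    (kernelFamilySU i B cfgU cfgW O par).e4 U' (.inl f) b =
      ⨆ E : BallY 𝔸, ⨆ μ : Fin (d + 1),
        supBlkS' i (β i.hN i.D i.hk b) (fun ν => cdS i (cfgU U') μ (O (cfgW U') (cdsS i (cfgU U') ν (liftY f (E : 𝔸))))) := rfl

/-- (3.44) OFF: `0`. [cite: Balaban1985BackgroundPropagators, (3.44) p.398, bookkeeping] -/
theorem kernelFamilySU_e4_inr (O : SiteOpY 𝔸 i) (par : SiteParY 𝔸 i) (U' : B.Cfg) (J : FBondY i → ℝ) (b : IBondY i) :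
    (kernelFamilySU i B cfgU cfgW O par).e4 U' (.inr J) b = 0 := rfl

/-- ★ (3.45) ON (`.inl f`, `.inl ζ`): `sup_E sup_{μ,ν} hqS (par U) α (ζ·∇_{U,μ} G′(W) ∇*_{U,ν} Λ)` — base transporters.
[cite: Balaban1985BackgroundPropagators, (3.45) p.398, (3.40) p.397, Thm 3.4 p.400] -/
theorem kernelFamilySU_h2_inl (O : SiteOpY 𝔸 i) (par : SiteParY 𝔸 i) (U' : B.Cfg) (f : SiteY i → ℝ) (α : ℝ) (z : SiteY i → ℝ) :
    (kernelFamilySU i B cfgU cfgW O par).h2 U' (.inl f) α (.inl z) =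
      ⨆ E : BallY 𝔸, ⨆ μ : Fin (d + 1), ⨆ ν : Fin (d + 1),
        hqS i (par (cfgU U')) α (fun w => ((z w : ℝ) : ℂ) • cdS i (cfgU U') μ (O (cfgW U') (cdsS i (cfgU U') ν (liftY f (E : 𝔸)))) w) := rfl

/-- (3.45) OFF: `0`. [cite: Balaban1985BackgroundPropagators, (3.45) p.398, bookkeeping] -/
theorem kernelFamilySU_h2_inr (O : SiteOpY 𝔸 i) (par : SiteParY 𝔸 i) (U' : B.Cfg) (J : FBondY i → ℝ) (α : ℝ) (ζ : (SiteY i → ℝ) ⊕ (FBondY i → ℝ)) :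
    (kernelFamilySU i B cfgU cfgW O par).h2 U' (.inr J) α ζ = 0 := rfl

/-- (3.46) ON (`.inl f`, `.inl h`): the six flat `L²` quantities of `G′(W)` with `∇_U`-letters, prefactors `η^{(2,1,1,0,0,0)}`.
[cite: Balaban1985BackgroundPropagators, (3.46) p.398, Thm 3.4 p.400, bookkeeping] -/
theorem kernelFamilySU_l2_inl (O : SiteOpY 𝔸 i) (par : SiteParY 𝔸 i) (n : Fin 6) (U' : B.Cfg) (f : SiteY i → ℝ) (hh : SiteY i → ℝ) :
    (kernelFamilySU i B cfgU cfgW O par).l2 n U' (.inl f) (.inl hh) =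
      etaS i ^ ((![2, 1, 1, 0, 0, 0] : Fin 6 → ℕ) n) * ⨆ E : BallY 𝔸,
        ((![l2OfY hh (O (cfgW U') (liftY f (E : 𝔸))),
            ⨆ μ : Fin (d + 1), l2OfY hh (cdS i (cfgU U') μ (O (cfgW U') (liftY f (E : 𝔸)))),
            ⨆ μ : Fin (d + 1), l2OfY hh (O (cfgW U') (cdsS i (cfgU U') μ (liftY f (E : 𝔸)))),
            ⨆ μ : Fin (d + 1), ⨆ ν : Fin (d + 1), l2OfY hh (cdS i (cfgU U') μ (O (cfgW U') (cdsS i (cfgU U') ν (liftY f (E : 𝔸))))),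
            ⨆ μ : Fin (d + 1), ⨆ ν : Fin (d + 1), l2OfY hh (cdS i (cfgU U') μ (cdS i (cfgU U') ν (O (cfgW U') (liftY f (E : 𝔸))))),
            ⨆ μ : Fin (d + 1), ⨆ ν : Fin (d + 1),
              l2OfY hh (O (cfgW U') (cdsS i (cfgU U') μ (cdsS i (cfgU U') ν (liftY f (E : 𝔸)))))] : Fin 6 → ℝ) n) := rfl

/-- (3.46) OFF: `0`. [cite: Balaban1985BackgroundPropagators, (3.46) p.398, bookkeeping] -/
theorem kernelFamilySU_l2_inr (O : SiteOpY 𝔸 i) (par : SiteParY 𝔸 i) (n : Fin 6) (U' : B.Cfg) (J : FBondY i → ℝ) (h : (SiteY i → ℝ) ⊕ (FBondY i → ℝ)) :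
    (kernelFamilySU i B cfgU cfgW O par).l2 n U' (.inr J) h = 0 := rfl

/-- (3.47) ON `.inl f`: the four weighted sups `|η^{epow n}·entry_n|_{(epow n + γ)}` of `G′(W)` with `∇_U`-letters.
[cite: Balaban1985BackgroundPropagators, (3.47) p.398, Thm 3.4 p.400, bookkeeping] -/
theorem kernelFamilySU_glob_inl (O : SiteOpY 𝔸 i) (par : SiteParY 𝔸 i) (n : Fin 4) (U' : B.Cfg) (f : SiteY i → ℝ) (γ : ℝ) :
    (kernelFamilySU i B cfgU cfgW O par).glob n U' (.inl f) γ =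
      ⨆ E : BallY 𝔸,
        ((![wNormSY i (2 + γ) (fun z => ((etaS i ^ 2 : ℝ) : ℂ) • O (cfgW U') (liftY f (E : 𝔸)) z),
            ⨆ μ : Fin (d + 1), wNormSY i (1 + γ) (fun z => ((etaS i : ℝ) : ℂ) • cdS i (cfgU U') μ (O (cfgW U') (liftY f (E : 𝔸))) z),
            ⨆ μ : Fin (d + 1), wNormSY i (1 + γ) (fun z => ((etaS i : ℝ) : ℂ) • O (cfgW U') (cdsS i (cfgU U') μ (liftY f (E : 𝔸))) z),
            wNormSY i γ (lapS i (cfgU U') (O (cfgW U') (liftY f (E : 𝔸))))] : Fin 4 → ℝ) n) := rfl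

/-- (3.47) OFF: `0`. [cite: Balaban1985BackgroundPropagators, (3.47) p.398, bookkeeping] -/
theorem kernelFamilySU_glob_inr (O : SiteOpY 𝔸 i) (par : SiteParY 𝔸 i) (n : Fin 4) (U' : B.Cfg) (J : FBondY i → ℝ) (γ : ℝ) :
    (kernelFamilySU i B cfgU cfgW O par).glob n U' (.inr J) γ = 0 := rfl

/-! ### §1.1 At a configuration whose two decodings AGREE (a base configuration of a coding) every member IS the record reading there -/

/-- (3.42) at a configuration with `cfgU U′ = cfgW U′`: the record's entries. [cite: Balaban1985BackgroundPropagators, (3.42) p.397, bookkeeping] -/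
theorem kernelFamilySU_e_congr (O : SiteOpY 𝔸 i) (par : SiteParY 𝔸 i) (n : Fin 4) {U' : B.Cfg} (h : cfgU U' = cfgW U') :
    (kernelFamilySU i B cfgU cfgW O par).e n U' = (kernelFamilyS i B cfgW O par).e n U' := by
  funext lam b
  rcases lam with f | J <;> simp only [kernelFamilySU, kernelFamilyS, h]
  all_goals rfl

/-- ★ (3.43) at a configuration with `cfgU U′ = cfgW U′`: the record's Hölder member (so R13-U1 changes NOTHING at base configurations).
[cite: Balaban1985BackgroundPropagators, (3.43) p.398, bookkeeping] -/
theorem kernelFamilySU_h1_congr (O : SiteOpY 𝔸 i) (par : SiteParY 𝔸 i) {U' : B.Cfg} (h : cfgU U' = cfgW U') :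
    (kernelFamilySU i B cfgU cfgW O par).h1 U' = (kernelFamilyS i B cfgW O par).h1 U' := by
  funext lam α ζ
  rcases lam with f | J <;> rcases ζ with z | w <;> simp only [kernelFamilySU, kernelFamilyS, h]
  all_goals rfl

/-- (3.44) at a configuration with `cfgU U′ = cfgW U′`: the record's member. [cite: Balaban1985BackgroundPropagators, (3.44) p.398, bookkeeping] -/
theorem kernelFamilySU_e4_congr (O : SiteOpY 𝔸 i) (par : SiteParY 𝔸 i) {U' : B.Cfg} (h : cfgU U' = cfgW U') :
    (kernelFamilySU i B cfgU cfgW O par).e4 U' = (kernelFamilyS i B cfgW O par).e4 U' := by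
  funext lam b
  rcases lam with f | J <;> simp only [kernelFamilySU, kernelFamilyS, h]

/-- ★ (3.45) at a configuration with `cfgU U′ = cfgW U′`: the record's Hölder member. [cite: Balaban1985BackgroundPropagators, (3.45) p.398, bookkeeping] -/
theorem kernelFamilySU_h2_congr (O : SiteOpY 𝔸 i) (par : SiteParY 𝔸 i) {U' : B.Cfg} (h : cfgU U' = cfgW U') :
    (kernelFamilySU i B cfgU cfgW O par).h2 U' = (kernelFamilyS i B cfgW O par).h2 U' := by
  funext lam α ζ
  rcases lam with f | J <;> rcases ζ with z | w <;> simp only [kernelFamilySU, kernelFamilyS, h]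

/-- (3.46) at a configuration with `cfgU U′ = cfgW U′`: the record's member. [cite: Balaban1985BackgroundPropagators, (3.46) p.398, bookkeeping] -/
theorem kernelFamilySU_l2_congr (O : SiteOpY 𝔸 i) (par : SiteParY 𝔸 i) (n : Fin 6) {U' : B.Cfg} (h : cfgU U' = cfgW U') :
    (kernelFamilySU i B cfgU cfgW O par).l2 n U' = (kernelFamilyS i B cfgW O par).l2 n U' := by
  funext lam hh
  rcases lam with f | J <;> rcases hh with z | w <;> simp only [kernelFamilySU, kernelFamilyS, h]

/-- (3.47) at a configuration with `cfgU U′ = cfgW U′`: the record's member. [cite: Balaban1985BackgroundPropagators, (3.47) p.398, bookkeeping] -/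
theorem kernelFamilySU_glob_congr (O : SiteOpY 𝔸 i) (par : SiteParY 𝔸 i) (n : Fin 4) {U' : B.Cfg} (h : cfgU U' = cfgW U') :
    (kernelFamilySU i B cfgU cfgW O par).glob n U' = (kernelFamilyS i B cfgW O par).glob n U' := by
  funext lam γ
  rcases lam with f | J <;> simp only [kernelFamilySU, kernelFamilyS, h]

/-! ## §2 The bond sector (G, 𝔾_D, G₁, 𝔾, G(Ω) − G(Ω′)): `kernelFamilyBU` -/

open Classical in
/-- ★ **THE U-LETTER TWO-CONFIGURATION READING OF A BOND-SECTOR LETTER** (Theorem 3.4's reading of `G(U′U)`): `kernelFamilyB` verbatim with `cdB ∕ cdsB ∕ lapB ∕ par`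
at the BASE `U := cfgU U′` and the operator at `W := cfgW U′`. [cite: Balaban1985BackgroundPropagators, Thm 3.3 p.399, Thm 3.4 p.400, (3.42)–(3.47) pp.397–398] -/
def kernelFamilyBU (O : BondOpY 𝔸 i) (par : BondParY 𝔸 i) :
    B9.KernelFamily (B9GeoNormsKLevelV1.geo9K i) B where
  e := fun n U' lam b => let U := cfgU U'; let W := cfgW U'; match lam with
    | .inr J => ⨆ E : BallY 𝔸,
        ((![supInB i (β i.hN i.D i.hk b) (O W (liftY J (E : 𝔸))),
            ⨆ ν : Fin (d + 1), supInB i (β i.hN i.D i.hk b) (cdB i U ν (O W (liftY J (E : 𝔸)))),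
            ⨆ ν : Fin (d + 1), supInB i (β i.hN i.D i.hk b) (O W (cdsB i U ν (liftY J (E : 𝔸)))),
            supInB i (β i.hN i.D i.hk b) (lapB i U (O W (liftY J (E : 𝔸))))] : Fin 4 → ℝ) n)
    | .inl _ => 0
  h1 := fun U' lam α ζ => let U := cfgU U'; let W := cfgW U'; match lam, ζ with
    | .inr J, .inr z => ⨆ E : BallY 𝔸,
        max (⨆ ν : Fin (d + 1), holderQB i (par U) α z (cdB i U ν (O W (liftY J (E : 𝔸)))))
          (⨆ ν : Fin (d + 1), holderQB i (par U) α z (O W (cdsB i U ν (liftY J (E : 𝔸)))))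
    | _, _ => 0
  e4 := fun U' lam b => let U := cfgU U'; let W := cfgW U'; match lam with
    | .inr J => ⨆ E : BallY 𝔸, ⨆ ν : Fin (d + 1), ⨆ μ : Fin (d + 1),
        supInB i (β i.hN i.D i.hk b) (cdB i U ν (O W (cdsB i U μ (liftY J (E : 𝔸)))))
    | .inl _ => 0
  h2 := fun U' lam α ζ => let U := cfgU U'; let W := cfgW U'; match lam, ζ with
    | .inr J, .inr z => ⨆ E : BallY 𝔸, ⨆ ν : Fin (d + 1), ⨆ μ : Fin (d + 1),
        holderQB i (par U) α z (cdB i U ν (O W (cdsB i U μ (liftY J (E : 𝔸)))))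
    | _, _ => 0
  l2 := fun n U' lam h => let U := cfgU U'; let W := cfgW U'; match lam, h with
    | .inr J, .inr hh => ⨆ E : BallY 𝔸,
        ((![l2OfY hh (O W (liftY J (E : 𝔸))),
            ⨆ ν : Fin (d + 1), l2OfY hh (cdB i U ν (O W (liftY J (E : 𝔸)))),
            ⨆ ν : Fin (d + 1), l2OfY hh (O W (cdsB i U ν (liftY J (E : 𝔸)))),
            ⨆ ν : Fin (d + 1), ⨆ μ : Fin (d + 1), l2OfY hh (cdB i U ν (O W (cdsB i U μ (liftY J (E : 𝔸))))),
            ⨆ ν : Fin (d + 1), ⨆ μ : Fin (d + 1), l2OfY hh (cdB i U ν (cdB i U μ (O W (liftY J (E : 𝔸))))),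
            ⨆ ν : Fin (d + 1), ⨆ μ : Fin (d + 1), l2OfY hh (O W (cdsB i U ν (cdsB i U μ (liftY J (E : 𝔸)))))] : Fin 6 → ℝ) n)
    | _, _ => 0
  glob := fun n U' lam γ => let U := cfgU U'; let W := cfgW U'; match lam with
    | .inr J => ⨆ E : BallY 𝔸,
        ((![wNormBY i (2 + γ) (O W (liftY J (E : 𝔸))),
            ⨆ ν : Fin (d + 1), wNormBY i (1 + γ) (cdB i U ν (O W (liftY J (E : 𝔸)))),
            ⨆ ν : Fin (d + 1), wNormBY i (1 + γ) (O W (cdsB i U ν (liftY J (E : 𝔸)))),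
            wNormBY i γ (lapB i U (O W (liftY J (E : 𝔸))))] : Fin 4 → ℝ) n)
    | .inl _ => 0

/-- at equal decodings the U-letter reading IS def-Y's one-configuration reading `kernelFamilyB`. [cite: Balaban1985BackgroundPropagators, Thm 3.3 p.399, bookkeeping] -/
theorem kernelFamilyBU_self (O : BondOpY 𝔸 i) (par : BondParY 𝔸 i) (cfg : B.Cfg → CfgY 𝔸 i) :
    kernelFamilyBU i B cfg cfg O par = kernelFamilyB i B cfg O par := rfl

/-- (3.42) of the bond sector ON `.inr J`: the four `supInB` entries of `G(W)` with `∇_U`-letters. [cite: Balaban1985BackgroundPropagators, Thm 3.3 p.399, (3.42) p.397, bookkeeping] -/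
theorem kernelFamilyBU_e_inr (O : BondOpY 𝔸 i) (par : BondParY 𝔸 i) (n : Fin 4) (U' : B.Cfg) (J : FBondY i → ℝ) (b : IBondY i) :
    (kernelFamilyBU i B cfgU cfgW O par).e n U' (.inr J) b =
      ⨆ E : BallY 𝔸,
        ((![supInB i (β i.hN i.D i.hk b) (O (cfgW U') (liftY J (E : 𝔸))),
            ⨆ ν : Fin (d + 1), supInB i (β i.hN i.D i.hk b) (cdB i (cfgU U') ν (O (cfgW U') (liftY J (E : 𝔸)))),
            ⨆ ν : Fin (d + 1), supInB i (β i.hN i.D i.hk b) (O (cfgW U') (cdsB i (cfgU U') ν (liftY J (E : 𝔸)))),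
            supInB i (β i.hN i.D i.hk b) (lapB i (cfgU U') (O (cfgW U') (liftY J (E : 𝔸))))] : Fin 4 → ℝ) n) := rfl

/-- (3.42) of the bond sector OFF (site-sector argument): `0`. [cite: Balaban1985BackgroundPropagators, (3.42) p.397, bookkeeping] -/
theorem kernelFamilyBU_e_inl (O : BondOpY 𝔸 i) (par : BondParY 𝔸 i) (n : Fin 4) (U' : B.Cfg) (f : SiteY i → ℝ) (b : IBondY i) :
    (kernelFamilyBU i B cfgU cfgW O par).e n U' (.inl f) b = 0 := rfl

/-- ★ (3.43) of the bond sector ON (`.inr J`, `.inr ζ`): `sup_E max (sup_ν holderQB (par U) α ζ (∇_{U,ν} G(W)Λ)) (sup_ν holderQB (par U) α ζ (G(W)∇*_{U,ν}Λ))` — base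
transporters. [cite: Balaban1985BackgroundPropagators, Thm 3.3 p.399, (3.43) p.398, (3.40) p.397, Thm 3.4 p.400] -/
theorem kernelFamilyBU_h1_inr (O : BondOpY 𝔸 i) (par : BondParY 𝔸 i) (U' : B.Cfg) (J : FBondY i → ℝ) (α : ℝ) (z : FBondY i → ℝ) :
    (kernelFamilyBU i B cfgU cfgW O par).h1 U' (.inr J) α (.inr z) =
      ⨆ E : BallY 𝔸,
        max (⨆ ν : Fin (d + 1), holderQB i (par (cfgU U')) α z (cdB i (cfgU U') ν (O (cfgW U') (liftY J (E : 𝔸)))))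
          (⨆ ν : Fin (d + 1), holderQB i (par (cfgU U')) α z (O (cfgW U') (cdsB i (cfgU U') ν (liftY J (E : 𝔸))))) := rfl

/-- (3.43) of the bond sector OFF: `0`. [cite: Balaban1985BackgroundPropagators, (3.43) p.398, bookkeeping] -/
theorem kernelFamilyBU_h1_inl (O : BondOpY 𝔸 i) (par : BondParY 𝔸 i) (U' : B.Cfg) (f : SiteY i → ℝ) (α : ℝ) (ζ : (SiteY i → ℝ) ⊕ (FBondY i → ℝ)) :
    (kernelFamilyBU i B cfgU cfgW O par).h1 U' (.inl f) α ζ = 0 := rfl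

/-- (3.44) of the bond sector ON `.inr J`: `sup_E sup_{ν,μ} supInB (∇_{U,ν} G(W) ∇*_{U,μ} Λ)`. [cite: Balaban1985BackgroundPropagators, (3.44) p.398, Thm 3.4 p.400, bookkeeping] -/
theorem kernelFamilyBU_e4_inr (O : BondOpY 𝔸 i) (par : BondParY 𝔸 i) (U' : B.Cfg) (J : FBondY i → ℝ) (b : IBondY i) :
    (kernelFamilyBU i B cfgU cfgW O par).e4 U' (.inr J) b =
      ⨆ E : BallY 𝔸, ⨆ ν : Fin (d + 1), ⨆ μ : Fin (d + 1),
        supInB i (β i.hN i.D i.hk b) (cdB i (cfgU U') ν (O (cfgW U') (cdsB i (cfgU U') μ (liftY J (E : 𝔸))))) := rfl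

/-- (3.44) of the bond sector OFF: `0`. [cite: Balaban1985BackgroundPropagators, (3.44) p.398, bookkeeping] -/
theorem kernelFamilyBU_e4_inl (O : BondOpY 𝔸 i) (par : BondParY 𝔸 i) (U' : B.Cfg) (f : SiteY i → ℝ) (b : IBondY i) :
    (kernelFamilyBU i B cfgU cfgW O par).e4 U' (.inl f) b = 0 := rfl

/-- ★ (3.45) of the bond sector ON (`.inr J`, `.inr ζ`): `sup_E sup_{ν,μ} holderQB (par U) α ζ (∇_{U,ν} G(W) ∇*_{U,μ} Λ)` — base transporters.
[cite: Balaban1985BackgroundPropagators, (3.45) p.398, (3.40) p.397, Thm 3.4 p.400] -/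
theorem kernelFamilyBU_h2_inr (O : BondOpY 𝔸 i) (par : BondParY 𝔸 i) (U' : B.Cfg) (J : FBondY i → ℝ) (α : ℝ) (z : FBondY i → ℝ) :
    (kernelFamilyBU i B cfgU cfgW O par).h2 U' (.inr J) α (.inr z) =
      ⨆ E : BallY 𝔸, ⨆ ν : Fin (d + 1), ⨆ μ : Fin (d + 1),
        holderQB i (par (cfgU U')) α z (cdB i (cfgU U') ν (O (cfgW U') (cdsB i (cfgU U') μ (liftY J (E : 𝔸))))) := rfl

/-- (3.45) of the bond sector OFF: `0`. [cite: Balaban1985BackgroundPropagators, (3.45) p.398, bookkeeping] -/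
theorem kernelFamilyBU_h2_inl (O : BondOpY 𝔸 i) (par : BondParY 𝔸 i) (U' : B.Cfg) (f : SiteY i → ℝ) (α : ℝ) (ζ : (SiteY i → ℝ) ⊕ (FBondY i → ℝ)) :
    (kernelFamilyBU i B cfgU cfgW O par).h2 U' (.inl f) α ζ = 0 := rfl

/-- (3.46) of the bond sector OFF (site-sector argument): `0`. [cite: Balaban1985BackgroundPropagators, (3.46) p.398, bookkeeping] -/
theorem kernelFamilyBU_l2_inl (O : BondOpY 𝔸 i) (par : BondParY 𝔸 i) (n : Fin 6) (U' : B.Cfg) (f : SiteY i → ℝ) (h : (SiteY i → ℝ) ⊕ (FBondY i → ℝ)) :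
    (kernelFamilyBU i B cfgU cfgW O par).l2 n U' (.inl f) h = 0 := rfl

/-- (3.47) of the bond sector ON `.inr J`: the four weighted sups of `G(W)` with `∇_U`-letters. [cite: Balaban1985BackgroundPropagators, (3.47) p.398, Thm 3.4 p.400, bookkeeping] -/
theorem kernelFamilyBU_glob_inr (O : BondOpY 𝔸 i) (par : BondParY 𝔸 i) (n : Fin 4) (U' : B.Cfg) (J : FBondY i → ℝ) (γ : ℝ) :
    (kernelFamilyBU i B cfgU cfgW O par).glob n U' (.inr J) γ =
      ⨆ E : BallY 𝔸,
        ((![wNormBY i (2 + γ) (O (cfgW U') (liftY J (E : 𝔸))),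
            ⨆ ν : Fin (d + 1), wNormBY i (1 + γ) (cdB i (cfgU U') ν (O (cfgW U') (liftY J (E : 𝔸)))),
            ⨆ ν : Fin (d + 1), wNormBY i (1 + γ) (O (cfgW U') (cdsB i (cfgU U') ν (liftY J (E : 𝔸)))),
            wNormBY i γ (lapB i (cfgU U') (O (cfgW U') (liftY J (E : 𝔸))))] : Fin 4 → ℝ) n) := rfl

/-- (3.47) of the bond sector OFF: `0`. [cite: Balaban1985BackgroundPropagators, (3.47) p.398, bookkeeping] -/
theorem kernelFamilyBU_glob_inl (O : BondOpY 𝔸 i) (par : BondParY 𝔸 i) (n : Fin 4) (U' : B.Cfg) (f : SiteY i → ℝ) (γ : ℝ) :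
    (kernelFamilyBU i B cfgU cfgW O par).glob n U' (.inl f) γ = 0 := rfl

/-! ### §2.1 At a configuration whose two decodings agree every bond-sector member IS the record reading there -/

/-- (3.42) at a configuration with `cfgU U′ = cfgW U′`: the record's entries. [cite: Balaban1985BackgroundPropagators, (3.42) p.397, bookkeeping] -/
theorem kernelFamilyBU_e_congr (O : BondOpY 𝔸 i) (par : BondParY 𝔸 i) (n : Fin 4) {U' : B.Cfg} (h : cfgU U' = cfgW U') :
    (kernelFamilyBU i B cfgU cfgW O par).e n U' = (kernelFamilyB i B cfgW O par).e n U' := by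
  funext lam b
  rcases lam with f | J <;> simp only [kernelFamilyBU, kernelFamilyB, h]

/-- ★ (3.43) at a configuration with `cfgU U′ = cfgW U′`: the record's Hölder member (so R13-U1 changes NOTHING at base configurations).
[cite: Balaban1985BackgroundPropagators, (3.43) p.398, bookkeeping] -/
theorem kernelFamilyBU_h1_congr (O : BondOpY 𝔸 i) (par : BondParY 𝔸 i) {U' : B.Cfg} (h : cfgU U' = cfgW U') :
    (kernelFamilyBU i B cfgU cfgW O par).h1 U' = (kernelFamilyB i B cfgW O par).h1 U' := by
  funext lam α ζ
  rcases lam with f | J <;> rcases ζ with z | w <;> simp only [kernelFamilyBU, kernelFamilyB, h]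

/-- (3.44) at a configuration with `cfgU U′ = cfgW U′`: the record's member. [cite: Balaban1985BackgroundPropagators, (3.44) p.398, bookkeeping] -/
theorem kernelFamilyBU_e4_congr (O : BondOpY 𝔸 i) (par : BondParY 𝔸 i) {U' : B.Cfg} (h : cfgU U' = cfgW U') :
    (kernelFamilyBU i B cfgU cfgW O par).e4 U' = (kernelFamilyB i B cfgW O par).e4 U' := by
  funext lam b
  rcases lam with f | J <;> simp only [kernelFamilyBU, kernelFamilyB, h]

/-- ★ (3.45) at a configuration with `cfgU U′ = cfgW U′`: the record's Hölder member. [cite: Balaban1985BackgroundPropagators, (3.45) p.398, bookkeeping] -/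
theorem kernelFamilyBU_h2_congr (O : BondOpY 𝔸 i) (par : BondParY 𝔸 i) {U' : B.Cfg} (h : cfgU U' = cfgW U') :
    (kernelFamilyBU i B cfgU cfgW O par).h2 U' = (kernelFamilyB i B cfgW O par).h2 U' := by
  funext lam α ζ
  rcases lam with f | J <;> rcases ζ with z | w <;> simp only [kernelFamilyBU, kernelFamilyB, h]

/-- (3.46) at a configuration with `cfgU U′ = cfgW U′`: the record's member. [cite: Balaban1985BackgroundPropagators, (3.46) p.398, bookkeeping] -/
theorem kernelFamilyBU_l2_congr (O : BondOpY 𝔸 i) (par : BondParY 𝔸 i) (n : Fin 6) {U' : B.Cfg} (h : cfgU U' = cfgW U') :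
    (kernelFamilyBU i B cfgU cfgW O par).l2 n U' = (kernelFamilyB i B cfgW O par).l2 n U' := by
  funext lam hh
  rcases lam with f | J <;> rcases hh with z | w <;> simp only [kernelFamilyBU, kernelFamilyB, h]

/-- (3.47) at a configuration with `cfgU U′ = cfgW U′`: the record's member. [cite: Balaban1985BackgroundPropagators, (3.47) p.398, bookkeeping] -/
theorem kernelFamilyBU_glob_congr (O : BondOpY 𝔸 i) (par : BondParY 𝔸 i) (n : Fin 4) {U' : B.Cfg} (h : cfgU U' = cfgW U') :
    (kernelFamilyBU i B cfgU cfgW O par).glob n U' = (kernelFamilyB i B cfgW O par).glob n U' := by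
  funext lam γ
  rcases lam with f | J <;> simp only [kernelFamilyBU, kernelFamilyB, h]

end Reading

/-! ## §3 At a member of record: with both decodings the identity over `bg9Y`, the readers ARE the record's `Gp` ∕ `GA` -/

section Record

variable (𝔸) (G : Subgroup 𝔸ˣ) (x : MemberY d ℓ hd hL b₀ b₁ Mstar) (𝔏 : CovLettersY 𝔸 x) (𝔈 : ExpLettersY 𝔸 G x)

/-- over the record's carrier `bg9Y` (configurations = `CfgY`, no pair memory) with `cfgU = cfgW = id`, the U-letter site-sector reading of `𝔏.Gp ∕ 𝔏.parS` IS
`operatorLayerYOfLetters`'s `Gp` — the reading at `G`-valued configurations is unchanged by R13-U1. [cite: Balaban1985BackgroundPropagators, Thm 3.1 p.397, bookkeeping] -/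
theorem kernelFamilySU_id_id_eq_Gp :
    kernelFamilySU x.toKIdx (bg9Y 𝔸 G x) (fun U => U) (fun U => U) 𝔏.Gp 𝔏.parS = (operatorLayerYOfLetters 𝔸 G x 𝔏 𝔈).Gp := rfl

/-- likewise the bond sector: the U-letter reading of `𝔏.GA ∕ 𝔏.parB` with `cfgU = cfgW = id` IS the record's `GA`. [cite: Balaban1985BackgroundPropagators, Thm 3.3 p.399, bookkeeping] -/
theorem kernelFamilyBU_id_id_eq_GA :
    kernelFamilyBU x.toKIdx (bg9Y 𝔸 G x) (fun U => U) (fun U => U) 𝔏.GA 𝔏.parB = (operatorLayerYOfLetters 𝔸 G x 𝔏 𝔈).GA := rfl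

end Record

end

end Literature.MathematicalPhysics.QuantumFieldTheory.Balaban1983to89.Node00.OpsYULetters
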